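import Mathlib
import HarnessLib
import Summits.NavierStokesRegularity.NavierStokesRegularity.Theorems.LocalSineTubeDoorSequentialVorticityDoor
import Summits.NavierStokesRegularity.NavierStokesRegularity.Theorems.PoloidalWindowDoorPoloidalWindowRigidityOneSlice

/-!
# The VELOCITY-WINDOW doors along sparse times (unconditional)

Cell ns-regularity-ideate, seat p6 (`--supports stmt-NavierStokesRegularity-20017`; rung N0-LocalTubeDoorSine neighbourhood).
Companion of `…SequentialVorticityDoor` with the zeroth-order scalar `F(x, A) = ‖x‖` (the velocity magnitude): a profile of
the Type-I class whose velocity VANISHES on a nonempty open window of ONE slice vanishes on that whole slice (real-analyticity,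
identity theorem), hence is translation-invariant there and so `v ≡ 0` (`…OneSlice.eq_zero_of_translate_eq_slice`, (N₁)); the
one-slice templates then give:

* `sequentialVelocityDoor` — classical Leray–Hopf from rapidly decaying data, LOCAL Type I at `(x₀,T)`, `U` nonempty open,
  `tₖ → T` in `[0,T)` with bounded gaps: `∫_U √(T−tₖ) ‖u(tₖ, x₀ + √(T−tₖ)y)‖ dy → 0` ⇒ backward bounded at `x₀`;
* `mostTimesVelocityDoor` — the same along all times outside an exceptional set of density → 0 at `T`.

(Compare S10 `LocalVelCompTubeDoor`: ONE velocity COMPONENT fading at ALL times; here the full velocity, but only along a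
sparse set of times.)

WHAT THIS IS NOT: not a claim about Navier–Stokes regularity (Clay A) — local, conditional-on-Type-I regularity CRITERIA;
establishment in the cell's sense needs the cross-family referee PASS + independent reproduction (bears_on LADDER-NS N0).
-/

noncomputable section

-- the summit and its single sub-problem share the name (CONVENTIONS §1), as in every Theorems file
set_option linter.dupNamespace false

namespace Summit.NavierStokesRegularity.NavierStokesRegularity.Theorems.LocalSineTubeDoorSequentialVelocityDoor

open MeasureTheory Set Function Filter Topology TopologicalSpace Metric
open scoped RealInnerProductSpace InnerProductSpace NNReal ENNReal
open Literature.Analysis Literature.Analysis.FluidPDE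
open Summit.NavierStokesRegularity.NavierStokesRegularity.Theorems.LocalSineTubeDoorProfileAlignedWindowRigidityAncient
open Summit.NavierStokesRegularity.NavierStokesRegularity.Theorems.PoloidalWindowDoorPoloidalWindowRigidityFlat
open Summit.NavierStokesRegularity.NavierStokesRegularity.Theorems.PoloidalWindowDoorPoloidalWindowRigidityOneSlice
open Summit.NavierStokesRegularity.NavierStokesRegularity.Theorems.LocalSineTubeDoorSequentialDoor
open Summit.NavierStokesRegularity.NavierStokesRegularity.Theorems.LocalSineTubeDoorMostTimesCrossDoor
open Summit.NavierStokesRegularity.NavierStokesRegularity.Theorems.LocalSineTubeDoorMostTimesFixedDirectionDoor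

/-- The velocity-magnitude scalar `F(x, A) = ‖x‖` is continuous in `(x, A)`. -/
theorem continuous_velNorm :
    Continuous fun q : EuclideanSpace ℝ (Fin 3) × (EuclideanSpace ℝ (Fin 3) →L[ℝ] EuclideanSpace ℝ (Fin 3)) => ‖q.1‖ :=
  continuous_norm.comp continuous_fst

/-- The zero set of `F(x, A) = ‖x‖` is invariant under positive rescalings. -/
theorem velNorm_zeroSet_invariant :
    ∀ (a b : ℝ), 0 < a → 0 < b → ∀ (x : EuclideanSpace ℝ (Fin 3))
      (A : EuclideanSpace ℝ (Fin 3) →L[ℝ] EuclideanSpace ℝ (Fin 3)), ‖a • x‖ = 0 ↔ ‖x‖ = 0 := by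
  intro a b ha _ x A
  rw [norm_smul, mul_eq_zero, Real.norm_eq_abs, abs_eq_zero, or_iff_right ha.ne']

/-- The one-slice profile crux for the velocity magnitude: a profile of the Type-I class whose velocity vanishes on a
nonempty open window of ONE slice vanishes on that slice (identity theorem), is translation-invariant there, hence
vanishes identically ((N₁), `eq_zero_of_translate_eq_slice`) and is not backward-singular. -/
theorem oneSliceCrux_velNorm :
    ∀ (C : ℝ) (v : ℝ → EuclideanSpace ℝ (Fin 3) → EuclideanSpace ℝ (Fin 3)),
      Literature.Analysis.FluidPDE.HasTypeITimeDecay C v →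
      ContinuousOn (Function.uncurry v) (Set.Iio (0 : ℝ) ×ˢ Set.univ) →
      (∀ s t : ℝ, s < t → t < 0 → ∀ x, v t x =
        Literature.Analysis.UnboundedOperators.heatExtension (v s) (t - s) x -
          Literature.Analysis.FluidPDE.oseenDuhamel 1 s v v t x) →
      (∀ t < 0, Literature.Analysis.FluidPDE.VectorCalculus.IsDivFree (v t)) →
      (∃ s < 0, ∃ U : Set (EuclideanSpace ℝ (Fin 3)), IsOpen U ∧ U.Nonempty ∧
        ∀ z ∈ U, (fun (x : EuclideanSpace ℝ (Fin 3)) (_ : EuclideanSpace ℝ (Fin 3) →L[ℝ] EuclideanSpace ℝ (Fin 3)) =>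
          ‖x‖) (v s z) (fderiv ℝ (v s) z) = 0) →
      ¬ Literature.Analysis.FluidPDE.IsBackwardSingularPoint v 0 := by
  intro C v hrate hcont hmild hdiv hwin
  obtain ⟨s, hs, U', hU', hne', hzero⟩ := hwin
  -- the slice vanishes on the window, hence everywhere (real-analyticity)
  have han : AnalyticOnNhd ℝ (v s) univ := analyticOnNhd_slice hcont (bdd_of_hasTypeITimeDecay hrate) hmild hs
  obtain ⟨z₀, hz₀⟩ := hne'
  have hev : v s =ᶠ[𝓝 z₀] 0 :=
    Filter.eventually_of_mem (hU'.mem_nhds hz₀) fun z hz => by simpa using hzero z hz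
  have hall : ∀ y, v s y = 0 := fun y =>
    han.eqOn_zero_of_preconnected_of_eventuallyEq_zero isPreconnected_univ (mem_univ z₀) hev (mem_univ y)
  -- a vanishing slice is translation-invariant along `e₁`, so the profile vanishes identically
  have he : (EuclideanSpace.single 0 1 : EuclideanSpace ℝ (Fin 3)) ≠ 0 := by
    intro h0
    have := congrArg (fun w : EuclideanSpace ℝ (Fin 3) => w 0) h0
    simp at this
  exact not_backwardSingular_of_zero
    (eq_zero_of_translate_eq_slice hrate hcont hmild hdiv hs he fun y l => by rw [hall, hall])

/-- **THE SEQUENTIAL VELOCITY-WINDOW DOOR (unconditional).**  See the module docstring. -/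
theorem sequentialVelocityDoor :
    ∀ (ν T : ℝ), 0 < ν → 0 < T → ∀ (u : ℝ → EuclideanSpace ℝ (Fin 3) → EuclideanSpace ℝ (Fin 3))
      (p : ℝ → EuclideanSpace ℝ (Fin 3) → ℝ),
    Literature.Analysis.FluidPDE.IsClassicalNSSolutionOn (Set.Ico 0 T) ν 0 u p →
    Literature.Analysis.FluidPDE.IsLerayHopfOn T ν 0 (u 0) u →
    Literature.Analysis.FluidPDE.HasRapidSpatialDecay (u 0) →
    ∀ (x₀ : EuclideanSpace ℝ (Fin 3)) (ρ M : ℝ), 0 < ρ →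
    (∀ t ∈ Set.Ico 0 T, T - ρ ^ 2 < t → ∀ x ∈ Metric.ball x₀ ρ, ‖u t x‖ * Real.sqrt (ν * (T - t)) ≤ M) →
    ∀ (U : Set (EuclideanSpace ℝ (Fin 3))), IsOpen U → U.Nonempty →
    ∀ (t : ℕ → ℝ) (c : ℝ), 0 < c → (∀ k, t k ∈ Set.Ico 0 T) → Filter.Tendsto t Filter.atTop (nhds T) →
    (∀ k, c * (T - t k) ≤ T - t (k + 1)) →
    Filter.Tendsto (fun k => ∫⁻ y in U, ENNReal.ofReal
      (Real.sqrt (T - t k) * ‖u (t k) (x₀ + Real.sqrt (T - t k) • y)‖)) Filter.atTop (nhds 0) →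
    Literature.Analysis.FluidPDE.IsBackwardBoundedAt u T x₀ := by
  intro ν T hν hT u p hsol hLH hdec x₀ ρ M hρ hM U hU hUne t c hc htk htT hgap hfade
  refine sequentialDoor_of_oneSliceWindowRigidity (fun x _ => ‖x‖) continuous_velNorm velNorm_zeroSet_invariant
    oneSliceCrux_velNorm ν T hν hT u p hsol hLH hdec x₀ ρ M hρ hM U hU hUne t c hc htk htT hgap ?_
  refine hfade.congr fun k => ?_
  refine lintegral_congr fun y => ?_
  have ht : 0 ≤ T - t k := (sub_pos.2 (htk k).2).le
  rw [norm_smul, Real.norm_eq_abs, abs_of_nonneg (Real.sqrt_nonneg _),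
    abs_of_nonneg (mul_nonneg (Real.sqrt_nonneg _) (norm_nonneg _))]

/-- **THE MOST-TIMES VELOCITY-WINDOW DOOR (unconditional).**  See the module docstring. -/
theorem mostTimesVelocityDoor :
    ∀ (ν T : ℝ), 0 < ν → 0 < T → ∀ (u : ℝ → EuclideanSpace ℝ (Fin 3) → EuclideanSpace ℝ (Fin 3))
      (p : ℝ → EuclideanSpace ℝ (Fin 3) → ℝ),
    Literature.Analysis.FluidPDE.IsClassicalNSSolutionOn (Set.Ico 0 T) ν 0 u p →
    Literature.Analysis.FluidPDE.IsLerayHopfOn T ν 0 (u 0) u →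
    Literature.Analysis.FluidPDE.HasRapidSpatialDecay (u 0) →
    ∀ (x₀ : EuclideanSpace ℝ (Fin 3)) (ρ M : ℝ), 0 < ρ →
    (∀ t ∈ Set.Ico 0 T, T - ρ ^ 2 < t → ∀ x ∈ Metric.ball x₀ ρ, ‖u t x‖ * Real.sqrt (ν * (T - t)) ≤ M) →
    ∀ (U : Set (EuclideanSpace ℝ (Fin 3))), IsOpen U → U.Nonempty →
    ∀ (E : Set ℝ), (∀ ε > 0, ∀ᶠ h in nhdsWithin (0 : ℝ) (Set.Ioi 0),
      MeasureTheory.volume (E ∩ Set.Ioo (T - h) T) ≤ ENNReal.ofReal (ε * h)) →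
    (∀ t : ℕ → ℝ, (∀ k, t k ∈ Set.Ico 0 T ∧ t k ∉ E) → Filter.Tendsto t Filter.atTop (nhds T) →
      Filter.Tendsto (fun k => ∫⁻ y in U, ENNReal.ofReal
        (Real.sqrt (T - t k) * ‖u (t k) (x₀ + Real.sqrt (T - t k) • y)‖)) Filter.atTop (nhds 0)) →
    Literature.Analysis.FluidPDE.IsBackwardBoundedAt u T x₀ := by
  intro ν T hν hT u p hsol hLH hdec x₀ ρ M hρ hM U hU hUne E hE hfadeE
  refine bandDoor_of_oneSliceWindowRigidity (fun x _ => ‖x‖) continuous_velNorm velNorm_zeroSet_invariant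
    oneSliceCrux_velNorm ν T hν hT u p hsol hLH hdec x₀ ρ M hρ hM U hU hUne (fun t' => t' ∉ E) (1 / 2) (by norm_num)
    (band_of_densityZero hT hE) fun t htk htT => ?_
  refine (hfadeE t htk htT).congr fun k => ?_
  refine lintegral_congr fun y => ?_
  rw [norm_smul, Real.norm_eq_abs, abs_of_nonneg (Real.sqrt_nonneg _),
    abs_of_nonneg (mul_nonneg (Real.sqrt_nonneg _) (norm_nonneg _))]

end Summit.NavierStokesRegularity.NavierStokesRegularity.Theorems.LocalSineTubeDoorSequentialVelocityDoor

end
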